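import Summits.RiemannHypothesis.RiemannHypothesis.Theorems.Splittings.LinearRayOnePointCover

/-!
# Linear ray, window A: `linearFactorH a` has a non-real zero for every `a ∈ [0.3193, 0.66]` (certified computation)

ONE `native_decide` evaluation of the window check (`LinearRayOnePointCoverDefs.lean`, soundness
`LinearRayOnePointCover.lean`): at `s = 8458/25 = 338.32` (just past the `H_0`-zero `2γ₆₃ = 338.189…` of the
close pair `γ₆₃/γ₆₄ = 169.09/169.91`), `210` forward y-cells (`ρ_y = 1`, `R_y = 12`), u-context
`mkOsaCtx 256 90 64 20 3 400 1 10 64 6`, scale `K = 2¹⁸⁰`, the one-point certificate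
`(K Re H_0(s))² < K Q_a(s)·(a K Re H_0(s) − K Re H_0′(s))` holds on each of the 23 consecutive boxes
`[0.3193, 0.34], [0.34, 0.36], …, [0.48, 0.50], [0.50, 0.515], …, [0.545, 0.56], [0.56, 0.57], …, [0.65, 0.66]`
(interval weights `[e^{−a₂y}, e^{−a₁y}]` carry the continuum of `a`; point data computed once ≈ 240 s, boxes ≈ 40 s).
Design numerics (kit j277200, uncertified): `h²/(Q(ah − h′))` grows from `0.019` (`a = 0.32`) to `0.13` (`a = 0.64`).
Result: `not_hasOnlyRealZeros_linearFactorH_of_mem_windowA`.  Axioms: std + the `native_decide` axiom of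
`linRayWindowA_check` (filed `--computational`).
HONEST LABEL: machinery refuting an RH-STRENGTHENING conjunct (the linear-factor ray of
`Literature/Barriers/RiemannHypothesis/NewmanConjecture.lean`); RH-free; nothing here bears on the truth of RH.
Provenance: rh-splitx-eng-5 g3 (cell rh-split, D-0116 arm; C15 / S-dbn-1 filler → kernel), monolith
`HOME/rh-splitx-eng-5/ray/LinearRayOnePointMono-v3.lean`.
-/

set_option linter.dupNamespace false

noncomputable section

namespace Summit.RiemannHypothesis.RiemannHypothesis.Theorems.Splittings.LinearRayOnePoint

open MeasureTheory Set
open Literature.NumberTheory.LFunctions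
open Literature.Analysis.ValidatedNumerics Literature.Analysis.ValidatedNumerics.NumericsMP
open Literature.Barriers.RiemannHypothesis (linearFactorH hasOnlyRealZeros_linearFactorH_neg_iff)
open Summit.RiemannHypothesis.RiemannHypothesis.Theorems

/-- **Certified window A** (`native_decide`): at `s = 8458/25 = 338.32` (210 forward y-cells, `ρ_y = 1`,
`R_y = 12`, scale `2¹⁸⁰`) the one-point check passes on the 23 consecutive boxes
`[0.3193, 0.34, 0.36, …, 0.50, 0.515, …, 0.56, 0.57, …, 0.66]`. [folklore] -/
theorem linRayWindowA_check :
    linRayCoverCheck { xn := 8458, xd := 25, rhoYn := 1, rhoYd := 1, RYn := 12, RYd := 1, CyB := 0, CyF := 210, dip := false }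
      [3193, 3400, 3600, 3800, 4000, 4200, 4400, 4600, 4800, 5000, 5150, 5300, 5450, 5600, 5700, 5800, 5900,
        6000, 6100, 6200, 6300, 6400, 6500, 6600] 10000 180 = true := by
  native_decide

/-- Window A: for every `a ∈ [0.3193, 0.66]`, `linearFactorH a` does not have only real zeros. [folklore] -/
theorem not_hasOnlyRealZeros_linearFactorH_of_mem_windowA {a : ℝ} (h1 : (3193 : ℝ) / 10000 ≤ a)
    (h2 : a ≤ (6600 : ℝ) / 10000) : ¬ HasOnlyRealZeros (linearFactorH a) :=
  linRayCoverCheck_sound linRayWindowA_check (by exact_mod_cast h1) (by exact_mod_cast h2)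

end Summit.RiemannHypothesis.RiemannHypothesis.Theorems.Splittings.LinearRayOnePoint

end
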